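import Literature.NumberTheory.Automorphic.GL2NewvectorUpToTwist
import HarnessLib

/-!
# Congruences for the unit ideles of `ℚ`: `ẑˣ / (1 + N ẑ) ≅ (ℤ/N)ˣ` through `Rat.redMod`

Topic `NumberTheory/Automorphic`; namespace `Literature.NumberTheory.Automorphic`. Elementary
support for the existence of the new vector on `GL₂(𝔸_ℚ)` (`GL2NewvectorExistence`): the reduction
`Rat.redMod N : 𝕀_ℚ → (ℤ/N)ˣ` of `HeckeCharacterProofs` (the `p`-adic unit parts mod `p^{v_p N}`,
glued by the Chinese remainder theorem), restricted to the finite unit ideles `ẑˣ = ∏_p ℤ_pˣ`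
(`Rat.finiteIntegralUnits`, placed in `𝕀_ℚ` by `Rat.finUnitHom y = (1, y)`), is the quotient map by
the congruence subgroup `1 + N ẑ`:

* `Rat.redMod_congr_primeFactors` — `redMod N` only sees the components at `p ∣ N`;
* `Rat.natUnitIdele N n` — the unit idele `(n at p ∣ N, 1 elsewhere)` of an integer `n` prime to `N`,
  with `redMod N (natUnitIdele N n) = n mod N` (`Rat.redMod_natUnitIdele`), whence
  **surjectivity** `Rat.exists_redMod_finUnitHom_eq` (Neukirch, Ch. VI, Prop. (1.9)–(1.10):
  `C_ℚ/C_ℚ^{N} ≅ (ℤ/N)ˣ`);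
* **the natural representative** `Rat.sub_natCast_redMod_mem_levelIdeal` — for `y ∈ ẑˣ`,
  `y ≡ (redMod N y)~ (mod N ẑ)` for the least natural lift `~` of the class (from the other half,
  `Rat.sub_one_mem_levelIdeal_of_redMod_eq_one` of `GL2NewvectorUpToTwist`);
* **compatibility** `Rat.unitsMap_redMod` — for `M ∣ N` and `y ∈ ẑˣ`, `redMod M y` is the image of
  `redMod N y`;
* `Rat.exists_natCast_mul_of_integral` — **`ẑ ∩ (𝔸_ℚ^∞)ˣ = ℕ_{>0} · ẑˣ`**: an integral finite idele is
  `m · w` with `m ≥ 1` an integer and `w ∈ ẑˣ` (class number one; Gelbart 1975, (3.3)).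

Everything is proved; the definitions are `Rat.finUnitHom`, `Rat.finiteIntegralUnits`,
`Rat.primePlaces`, `Rat.natUnitIdele`.

## References

* J. Neukirch, *Algebraic Number Theory* (1999), Ch. VI §1, Prop. (1.9)–(1.10) [NeukirchANT1999].
* S. Gelbart, *Automorphic forms on adele groups* (1975), (3.3) [Gelbart1975].
-/

noncomputable section

open scoped MatrixGroups Classical
open NumberField IsDedekindDomain

namespace Literature.NumberTheory.Automorphic

open GaloisRepresentations Rat.HeightOneSpectrum IsDedekindDomain.HeightOneSpectrum

attribute [local instance] Rat.fact_prime_natGenerator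

/-! ### Finite ideles inside `𝕀_ℚ`, and `ẑˣ` -/

section FinUnit

/-- The finite idele `y` as the idele `(1_∞, y)` (Mathlib `MonoidHom.inr` on units). [folklore] -/
def Rat.finUnitHom : (FiniteAdeleRing (𝓞 ℚ) ℚ)ˣ →* ideleGroup ℚ :=
  Units.map (MonoidHom.inr (InfiniteAdeleRing ℚ) (FiniteAdeleRing (𝓞 ℚ) ℚ))

/-- The value of `Rat.finUnitHom y` is `(1, y)`. [folklore] -/
theorem Rat.coe_finUnitHom (y : (FiniteAdeleRing (𝓞 ℚ) ℚ)ˣ) :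
    ((Rat.finUnitHom y : ideleGroup ℚ) : AdeleRing (𝓞 ℚ) ℚ) = ((1 : InfiniteAdeleRing ℚ), (y : FiniteAdeleRing (𝓞 ℚ) ℚ)) :=
  rfl

/-- `(1, y)_∞ = 1`. [folklore] -/
@[simp] theorem Rat.finUnitHom_fst (y : (FiniteAdeleRing (𝓞 ℚ) ℚ)ˣ) :
    ((Rat.finUnitHom y : ideleGroup ℚ) : AdeleRing (𝓞 ℚ) ℚ).1 = 1 := rfl

/-- `(1, y)_f = y`. [folklore] -/
@[simp] theorem Rat.finUnitHom_snd (y : (FiniteAdeleRing (𝓞 ℚ) ℚ)ˣ) :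
    ((Rat.finUnitHom y : ideleGroup ℚ) : AdeleRing (𝓞 ℚ) ℚ).2 = (y : FiniteAdeleRing (𝓞 ℚ) ℚ) := rfl

/-- **`ẑˣ = ∏_p ℤ_pˣ`**: the finite ideles all of whose components are units (carrier
`Valued.v (y_v) = 1`). This is the `K = ℚ` case of the tree's `Meyer.integralFiniteUnits K`
(`MeyerDifferenceRepresentation`, carrier `u_v, u_v⁻¹ ∈ 𝒪_v`), which is the SURVIVOR name for `𝒪̂ˣ`;
that file is not imported here (it carries the analytic Meyer cone, outside the 92-file closure of
`GL2NewvectorUpToTwist`), and the bridge `Rat.finiteIntegralUnits = Meyer.integralFiniteUnits ℚ` is proved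
in `RatIdeleCongruenceBridge` so that the two names cannot drift apart. [folklore] -/
def Rat.finiteIntegralUnits : Subgroup (FiniteAdeleRing (𝓞 ℚ) ℚ)ˣ where
  carrier := {y | ∀ v : HeightOneSpectrum (𝓞 ℚ), Valued.v ((y : FiniteAdeleRing (𝓞 ℚ) ℚ) v) = 1}
  one_mem' := fun v => by
    rw [Units.val_one]
    exact Valuation.map_one _
  mul_mem' := fun {a b} ha hb v => by
    rw [Units.val_mul, FiniteAdeleRing.mul_apply', Valuation.map_mul, ha v, hb v, one_mul]
  inv_mem' := fun {a} ha v => by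
    have h : ((a : FiniteAdeleRing (𝓞 ℚ) ℚ) v) * ((((a⁻¹ : (FiniteAdeleRing (𝓞 ℚ) ℚ)ˣ) : FiniteAdeleRing (𝓞 ℚ) ℚ) v)) = 1 := by
      rw [← FiniteAdeleRing.mul_apply', Units.mul_inv]; rfl
    have h' := congrArg Valued.v h
    rw [Valuation.map_mul, Valuation.map_one, ha v, one_mul] at h'
    exact h'

/-- Membership in `ẑˣ`. [folklore] -/
theorem Rat.mem_finiteIntegralUnits_iff {y : (FiniteAdeleRing (𝓞 ℚ) ℚ)ˣ} :
    y ∈ Rat.finiteIntegralUnits ↔ ∀ v : HeightOneSpectrum (𝓞 ℚ), Valued.v ((y : FiniteAdeleRing (𝓞 ℚ) ℚ) v) = 1 :=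
  Iff.rfl

/-- The components of `(1, y)` are units for `y ∈ ẑˣ` (the hypothesis `hunit` of the `redMod`
lemmas of `GL2NewvectorUpToTwist`). [folklore] -/
theorem Rat.valued_finUnitHom_snd {y : (FiniteAdeleRing (𝓞 ℚ) ℚ)ˣ} (hy : y ∈ Rat.finiteIntegralUnits)
    (v : HeightOneSpectrum (𝓞 ℚ)) : Valued.v (((Rat.finUnitHom y : ideleGroup ℚ) : AdeleRing (𝓞 ℚ) ℚ).2 v) = 1 :=
  hy v

/-- Elements of `ẑˣ` are integral. [folklore] -/
theorem Rat.mem_integralFiniteAdeles_of_mem_finiteIntegralUnits {y : (FiniteAdeleRing (𝓞 ℚ) ℚ)ˣ}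
    (hy : y ∈ Rat.finiteIntegralUnits) : (y : FiniteAdeleRing (𝓞 ℚ) ℚ) ∈ integralFiniteAdeles ℚ :=
  fun v => (mem_adicCompletionIntegers (𝓞 ℚ) ℚ v).2 (hy v).le

end FinUnit

/-! ### `redMod N` only sees the components at `p ∣ N` -/

section RedMod

variable {N : ℕ} [NeZero N]

/-- Two ideles with the same components at the places dividing `N` have the same reduction mod `N`
(`Rat.localRed_congr` at each prime factor, glued by the Chinese remainder theorem). [folklore] -/
theorem Rat.redMod_congr_primeFactors {x y : ideleGroup ℚ}
    (h : ∀ q : N.primeFactors, (x : AdeleRing (𝓞 ℚ) ℚ).2 (Rat.placeOfFactor N q) = (y : AdeleRing (𝓞 ℚ) ℚ).2 (Rat.placeOfFactor N q)) :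
    Rat.redMod N x = Rat.redMod N y := by
  refine Units.ext ((ZMod.equivPi (n := N) (NeZero.ne N)).injective (funext fun q => ?_))
  rw [Rat.equivPi_redMod, Rat.equivPi_redMod, Rat.val_localRedFactor, Rat.val_localRedFactor,
    Rat.localRed_congr _ _ (h q)]

end RedMod

/-! ### The unit idele of an integer prime to `N` -/

section NatUnitIdele

variable (N : ℕ) [NeZero N]

/-- The finite set of places of `ℚ` over the prime factors of `N`. [folklore] -/
def Rat.primePlaces : Finset (HeightOneSpectrum (𝓞 ℚ)) :=
  (Finset.univ : Finset N.primeFactors).image (Rat.placeOfFactor N)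

variable {N}

/-- `w ∈ primePlaces N ↔ p_w ∣ N`. [folklore] -/
theorem Rat.mem_primePlaces_iff {w : HeightOneSpectrum (𝓞 ℚ)} : w ∈ Rat.primePlaces N ↔ natGenerator w ∣ N := by
  rw [Rat.primePlaces, Finset.mem_image]
  constructor
  · rintro ⟨q, -, rfl⟩
    exact Rat.natGenerator_placeOfFactor_dvd N q
  · intro hw
    obtain ⟨q, hq⟩ := Rat.exists_placeOfFactor_eq hw
    exact ⟨q, Finset.mem_univ _, hq⟩

variable (N)

/-- **The unit idele of `n ∈ ℕ`, `n ≠ 0`**: the idele `(n at the places dividing N, 1 elsewhere)`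
(a finite product of local ideles, `localUnits`). For `n` prime to `N` it lies in `ẑˣ` and
represents `n mod N` under `redMod N`. [folklore] -/
def Rat.natUnitIdele (n : ℕ) (hn0 : (n : ℚ) ≠ 0) : ideleGroup ℚ :=
  ∏ w ∈ Rat.primePlaces N, localUnits w (globalToLocalUnits w (Units.mk0 (n : ℚ) hn0))

variable {N}

omit [NeZero N] in
/-- The archimedean component of `natUnitIdele` is `1`. [folklore] -/
theorem Rat.natUnitIdele_fst (n : ℕ) (hn0 : (n : ℚ) ≠ 0) :
    ((Rat.natUnitIdele N n hn0 : ideleGroup ℚ) : AdeleRing (𝓞 ℚ) ℚ).1 = 1 := by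
  rw [Rat.natUnitIdele, ← ideleGroup.infComp_apply, map_prod]
  refine Finset.prod_eq_one fun w _ => ?_
  rw [ideleGroup.infComp_apply, localUnits_fst]

/-- The finite components of `natUnitIdele`: `n` at `p ∣ N`, `1` elsewhere. [folklore] -/
theorem Rat.natUnitIdele_snd (n : ℕ) (hn0 : (n : ℚ) ≠ 0) (w : HeightOneSpectrum (𝓞 ℚ)) :
    ((Rat.natUnitIdele N n hn0 : ideleGroup ℚ) : AdeleRing (𝓞 ℚ) ℚ).2 w =
      if natGenerator w ∣ N then algebraMap ℚ (w.adicCompletion ℚ) (n : ℚ) else 1 := by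
  rw [Rat.natUnitIdele, snd_prod_localUnits]
  by_cases hw : natGenerator w ∣ N
  · rw [if_pos (Rat.mem_primePlaces_iff.2 hw), if_pos hw, val_globalToLocalUnits, Units.val_mk0]
  · rw [if_neg (fun h => hw (Rat.mem_primePlaces_iff.1 h)), if_neg hw]

/-- For `n` prime to `N`, all finite components of `natUnitIdele N n` are units. [folklore] -/
theorem Rat.valued_natUnitIdele_snd {n : ℕ} (hn : n.Coprime N) (hn0 : (n : ℚ) ≠ 0) (w : HeightOneSpectrum (𝓞 ℚ)) :
    Valued.v (((Rat.natUnitIdele N n hn0 : ideleGroup ℚ) : AdeleRing (𝓞 ℚ) ℚ).2 w) = 1 := by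
  rw [Rat.natUnitIdele_snd]
  split_ifs with hw
  · rw [GaloisRepresentations.valued_algebraMap_adicCompletion, ← Int.cast_natCast]
    refine Rat.valuation_intCast_eq_one w ?_
    rw [Int.natCast_dvd_natCast]
    intro hdvd
    have h1 : natGenerator w ∣ Nat.gcd n N := Nat.dvd_gcd hdvd hw
    rw [hn] at h1
    exact (prime_natGenerator w).one_lt.ne' (Nat.dvd_one.1 h1)
  · exact Valuation.map_one _

/-- **`redMod N (natUnitIdele N n) = n mod N`** for `n` prime to `N` (same components as the
principal idele `(n)` at the places dividing `N`; `Rat.redMod_principalIdele_natCast`).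
[cite: NeukirchANT1999, Ch. VI Prop. (1.10)] -/
theorem Rat.redMod_natUnitIdele {n : ℕ} (hn : n.Coprime N) (hn0 : (n : ℚ) ≠ 0) :
    Rat.redMod N (Rat.natUnitIdele N n hn0) = ZMod.unitOfCoprime n hn := by
  rw [← Rat.redMod_principalIdele_natCast N hn hn0]
  refine Rat.redMod_congr_primeFactors fun q => ?_
  rw [Rat.natUnitIdele_snd, if_pos (Rat.natGenerator_placeOfFactor_dvd N q), principalIdele_snd, Units.val_mk0]

/-- The finite part of `natUnitIdele` as a finite idele in `ẑˣ`. [folklore] -/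
def Rat.natFinUnit (N : ℕ) [NeZero N] (n : ℕ) (hn0 : (n : ℚ) ≠ 0) : (FiniteAdeleRing (𝓞 ℚ) ℚ)ˣ :=
  Units.map (MonoidHom.snd (InfiniteAdeleRing ℚ) (FiniteAdeleRing (𝓞 ℚ) ℚ))
    (show (InfiniteAdeleRing ℚ × FiniteAdeleRing (𝓞 ℚ) ℚ)ˣ from Rat.natUnitIdele N n hn0)

/-- `(1, (natUnitIdele)_f) = natUnitIdele` (its archimedean component is `1`). [folklore] -/
theorem Rat.finUnitHom_natFinUnit (n : ℕ) (hn0 : (n : ℚ) ≠ 0) :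
    Rat.finUnitHom (Rat.natFinUnit N n hn0) = Rat.natUnitIdele N n hn0 := by
  refine Units.ext (Prod.ext ?_ rfl)
  exact (Rat.natUnitIdele_fst (N := N) n hn0).symm

/-- The components of `natFinUnit`. [folklore] -/
theorem Rat.natFinUnit_apply (n : ℕ) (hn0 : (n : ℚ) ≠ 0) (w : HeightOneSpectrum (𝓞 ℚ)) :
    (Rat.natFinUnit N n hn0 : FiniteAdeleRing (𝓞 ℚ) ℚ) w =
      if natGenerator w ∣ N then algebraMap ℚ (w.adicCompletion ℚ) (n : ℚ) else 1 :=
  Rat.natUnitIdele_snd (N := N) n hn0 w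

/-- `natFinUnit N n ∈ ẑˣ` for `n` prime to `N`. [folklore] -/
theorem Rat.natFinUnit_mem {n : ℕ} (hn : n.Coprime N) (hn0 : (n : ℚ) ≠ 0) :
    Rat.natFinUnit N n hn0 ∈ Rat.finiteIntegralUnits := fun w =>
  Rat.valued_natUnitIdele_snd (N := N) hn hn0 w

/-- `(natFinUnit N n) - n ∈ N ẑ`: the unit idele of `n` is congruent to `n` mod `N ẑ` (equal at the
places dividing `N`, and `1 - n` is integral elsewhere). [folklore] -/
theorem Rat.natFinUnit_sub_natCast_mem_levelIdeal {n : ℕ} (hn0 : (n : ℚ) ≠ 0) :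
    (Rat.natFinUnit N n hn0 : FiniteAdeleRing (𝓞 ℚ) ℚ) - algebraMap ℚ (FiniteAdeleRing (𝓞 ℚ) ℚ) (n : ℚ) ∈
      levelIdeal ℚ (Ideal.span {(N : 𝓞 ℚ)}) := by
  rw [mem_levelIdeal_iff]
  intro w
  rw [FiniteAdeleRing.sub_apply', Rat.natFinUnit_apply, FiniteAdeleRing.algebraMap_apply, adicCompletion_coe_eq_algebraMap]
  split_ifs with hw
  · rw [sub_self, Valuation.map_zero]
    exact zero_le
  · rw [idealRadius_eq_one_of_not_dvd (Rat.span_natCast_ne_zero N) (mt (Rat.natGenerator_dvd_iff w N).2 hw)]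
    refine (Valuation.map_sub _ _ _).trans (max_le ?_ ?_)
    · rw [Valuation.map_one]
    · rw [GaloisRepresentations.valued_algebraMap_adicCompletion, ← map_natCast (algebraMap (𝓞 ℚ) ℚ), valuation_of_algebraMap]
      exact intValuation_le_one w _

end NatUnitIdele

/-! ### `ẑˣ → (ℤ/N)ˣ` is onto, with natural representatives, compatibly in `N` -/

section Congruence

variable {N : ℕ} [NeZero N]

/-- **Surjectivity of `redMod N` on `ẑˣ`**: every class of `(ℤ/N)ˣ` is `redMod N (1, y)` for some
`y ∈ ẑˣ` (the unit idele of the least natural representative). Neukirch, Ch. VI, Prop. (1.9)–(1.10):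
`𝕀_ℚ / ℚˣ ℝ_{>0} (1 + N ẑ) ≅ (ℤ/N)ˣ`. [cite: NeukirchANT1999, Ch. VI Prop. (1.10)] -/
theorem Rat.exists_redMod_finUnitHom_eq (a : (ZMod N)ˣ) :
    ∃ y ∈ Rat.finiteIntegralUnits, Rat.redMod N (Rat.finUnitHom y) = a := by
  by_cases hN1 : N = 1
  · subst hN1
    refine ⟨1, one_mem _, Subsingleton.elim _ _⟩
  set n : ℕ := (a : ZMod N).val with hn
  have hnN : n.Coprime N := ZMod.val_coe_unit_coprime a
  have hna : (n : ZMod N) = a := ZMod.natCast_zmod_val _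
  have hn0' : n ≠ 0 := fun h => by
    rw [h, Nat.coprime_zero_left] at hnN
    exact hN1 hnN
  have hn0 : (n : ℚ) ≠ 0 := by exact_mod_cast hn0'
  refine ⟨Rat.natFinUnit N n hn0, Rat.natFinUnit_mem hnN hn0, ?_⟩
  rw [Rat.finUnitHom_natFinUnit, Rat.redMod_natUnitIdele hnN hn0]
  exact Units.ext (by rw [ZMod.coe_unitOfCoprime, hna])

/-- **The natural representative**: for `y ∈ ẑˣ` and `ñ ∈ ℕ` the least lift of `redMod N (1, y)`,
`y - ñ ∈ N ẑ`. Proof: the unit idele `u` of `ñ` has `redMod N u = redMod N y`, so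
`redMod N (y u⁻¹) = 1` and `y u⁻¹ ≡ 1 (mod N ẑ)` (`Rat.sub_one_mem_levelIdeal_of_redMod_eq_one`),
while `u ≡ ñ (mod N ẑ)`. [cite: NeukirchANT1999, Ch. VI Prop. (1.10)] -/
theorem Rat.sub_natCast_redMod_mem_levelIdeal {y : (FiniteAdeleRing (𝓞 ℚ) ℚ)ˣ} (hy : y ∈ Rat.finiteIntegralUnits) :
    (y : FiniteAdeleRing (𝓞 ℚ) ℚ) -
        algebraMap ℚ (FiniteAdeleRing (𝓞 ℚ) ℚ) (((Rat.redMod N (Rat.finUnitHom y) : (ZMod N)ˣ) : ZMod N).val : ℚ) ∈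
      levelIdeal ℚ (Ideal.span {(N : 𝓞 ℚ)}) := by
  set a : (ZMod N)ˣ := Rat.redMod N (Rat.finUnitHom y) with ha
  set n : ℕ := (a : ZMod N).val with hn
  by_cases hN1 : N = 1
  · -- `levelIdeal (1) = ẑ`
    subst hN1
    rw [mem_levelIdeal_iff]
    intro w
    rw [idealRadius_eq_one_of_not_dvd (Rat.span_natCast_ne_zero 1)
      (mt (Rat.natGenerator_dvd_iff w 1).2 (Nat.Prime.not_dvd_one (prime_natGenerator w))),
      FiniteAdeleRing.sub_apply', FiniteAdeleRing.algebraMap_apply, adicCompletion_coe_eq_algebraMap]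
    refine (Valuation.map_sub _ _ _).trans (max_le (hy w).le ?_)
    rw [GaloisRepresentations.valued_algebraMap_adicCompletion, ← map_natCast (algebraMap (𝓞 ℚ) ℚ), valuation_of_algebraMap]
    exact intValuation_le_one w _
  have hnN : n.Coprime N := ZMod.val_coe_unit_coprime a
  have hna : (n : ZMod N) = a := ZMod.natCast_zmod_val _
  have hn0' : n ≠ 0 := fun h => by
    rw [h, Nat.coprime_zero_left] at hnN
    exact hN1 hnN
  have hn0 : (n : ℚ) ≠ 0 := by exact_mod_cast hn0'
  set u : (FiniteAdeleRing (𝓞 ℚ) ℚ)ˣ := Rat.natFinUnit N n hn0 with hu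
  have huG : u ∈ Rat.finiteIntegralUnits := Rat.natFinUnit_mem hnN hn0
  -- `redMod N (y u⁻¹) = 1`
  have hred : Rat.redMod N (Rat.finUnitHom (y * u⁻¹)) = 1 := by
    rw [map_mul, map_inv, map_mul, map_inv, hu, Rat.finUnitHom_natFinUnit, Rat.redMod_natUnitIdele hnN hn0, ← ha]
    have e : ZMod.unitOfCoprime n hnN = a := Units.ext (by rw [ZMod.coe_unitOfCoprime, hna])
    rw [e, mul_inv_cancel]
  have hsub := Rat.sub_one_mem_levelIdeal_of_redMod_eq_one (Rat.valued_finUnitHom_snd (mul_mem hy (inv_mem huG))) hred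
  rw [Rat.finUnitHom_snd] at hsub
  -- `y - n = u (y u⁻¹ - 1) + (u - n)`
  have e : (y : FiniteAdeleRing (𝓞 ℚ) ℚ) - algebraMap ℚ (FiniteAdeleRing (𝓞 ℚ) ℚ) (n : ℚ) =
      (u : FiniteAdeleRing (𝓞 ℚ) ℚ) * (((y * u⁻¹ : (FiniteAdeleRing (𝓞 ℚ) ℚ)ˣ) : FiniteAdeleRing (𝓞 ℚ) ℚ) - 1) +
        ((u : FiniteAdeleRing (𝓞 ℚ) ℚ) - algebraMap ℚ (FiniteAdeleRing (𝓞 ℚ) ℚ) (n : ℚ)) := by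
    rw [mul_sub, mul_one, Units.val_mul, ← mul_assoc, mul_comm (u : FiniteAdeleRing (𝓞 ℚ) ℚ) (y : FiniteAdeleRing (𝓞 ℚ) ℚ),
      mul_assoc, ← Units.val_mul, mul_inv_cancel, Units.val_one, mul_one]
    ring
  rw [e]
  exact add_mem (mul_mem_levelIdeal (Rat.mem_integralFiniteAdeles_of_mem_finiteIntegralUnits huG) hsub)
    (Rat.natFinUnit_sub_natCast_mem_levelIdeal hn0)

/-- `N ẑ ⊆ M ẑ` for `M ∣ N`: the case `𝔪 = (N) ≤ (M) = 𝔫` of the tree's `levelIdeal_mono`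
(`FiniteAdeleSchwartzBruhatFourier`, not in this import cone), through `idealRadius_mono`
(`UnramifiedHeckeLevel`). [folklore] -/
theorem Rat.levelIdeal_le_of_dvd {M N : ℕ} (hN : N ≠ 0) (h : M ∣ N) :
    levelIdeal ℚ (Ideal.span {(N : 𝓞 ℚ)}) ≤ levelIdeal ℚ (Ideal.span {(M : 𝓞 ℚ)}) := fun x hx v =>
  (hx v).trans (idealRadius_mono ℚ v (by haveI : NeZero N := ⟨hN⟩; exact Rat.span_natCast_ne_zero N)
    (Ideal.span_singleton_le_span_singleton.2 (Nat.cast_dvd_cast h)))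

/-- **Compatibility of the reductions**: for `M ∣ N` and `y ∈ ẑˣ`, `redMod M (1, y)` is the image of
`redMod N (1, y)` in `(ℤ/M)ˣ` (both are represented by the natural representative of `redMod N (1, y)`,
`Rat.sub_natCast_redMod_mem_levelIdeal`, and two integers congruent mod `M ẑ` are congruent mod `M`).
[cite: NeukirchANT1999, Ch. VI Prop. (1.10)] -/
theorem Rat.unitsMap_redMod {M : ℕ} [NeZero M] (hMN : M ∣ N) {y : (FiniteAdeleRing (𝓞 ℚ) ℚ)ˣ}
    (hy : y ∈ Rat.finiteIntegralUnits) :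
    ZMod.unitsMap hMN (Rat.redMod N (Rat.finUnitHom y)) = Rat.redMod M (Rat.finUnitHom y) := by
  set n : ℕ := ((Rat.redMod N (Rat.finUnitHom y) : (ZMod N)ˣ) : ZMod N).val with hn
  set n' : ℕ := ((Rat.redMod M (Rat.finUnitHom y) : (ZMod M)ˣ) : ZMod M).val with hn'
  have h1 : (y : FiniteAdeleRing (𝓞 ℚ) ℚ) - algebraMap ℚ (FiniteAdeleRing (𝓞 ℚ) ℚ) (n : ℚ) ∈
      levelIdeal ℚ (Ideal.span {(M : 𝓞 ℚ)}) :=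
    Rat.levelIdeal_le_of_dvd (NeZero.ne N) hMN (Rat.sub_natCast_redMod_mem_levelIdeal hy)
  have h2 : (y : FiniteAdeleRing (𝓞 ℚ) ℚ) - algebraMap ℚ (FiniteAdeleRing (𝓞 ℚ) ℚ) (n' : ℚ) ∈
      levelIdeal ℚ (Ideal.span {(M : 𝓞 ℚ)}) := Rat.sub_natCast_redMod_mem_levelIdeal hy
  -- `n' - n ∈ M ẑ ∩ ℚ = M ℤ`
  have h3 : algebraMap ℚ (FiniteAdeleRing (𝓞 ℚ) ℚ) ((n : ℚ) - (n' : ℚ)) ∈ levelIdeal ℚ (Ideal.span {(M : 𝓞 ℚ)}) := by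
    have e : algebraMap ℚ (FiniteAdeleRing (𝓞 ℚ) ℚ) ((n : ℚ) - (n' : ℚ)) =
        ((y : FiniteAdeleRing (𝓞 ℚ) ℚ) - algebraMap ℚ (FiniteAdeleRing (𝓞 ℚ) ℚ) (n' : ℚ)) -
          ((y : FiniteAdeleRing (𝓞 ℚ) ℚ) - algebraMap ℚ (FiniteAdeleRing (𝓞 ℚ) ℚ) (n : ℚ)) := by
      rw [map_sub]; ring
    rw [e]
    exact sub_mem h2 h1
  rw [Rat.algebraMap_mem_levelIdeal_iff (NeZero.ne M)] at h3
  obtain ⟨z, hz⟩ := Rat.exists_eq_natCast_mul_of_valuation_le (NeZero.ne M) h3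
  have hzZ : ((n : ℤ) - (n' : ℤ) : ℤ) = (M : ℤ) * z := by exact_mod_cast hz
  have hzmod : ((n : ℤ) : ZMod M) = ((n' : ℤ) : ZMod M) := by
    rw [ZMod.intCast_eq_intCast_iff_dvd_sub]
    exact ⟨-z, by rw [mul_neg, ← hzZ]; ring⟩
  refine Units.ext ?_
  rw [ZMod.unitsMap_def, Units.coe_map, MonoidHom.coe_coe]
  have en : ((Rat.redMod N (Rat.finUnitHom y) : (ZMod N)ˣ) : ZMod N) = (n : ZMod N) := (ZMod.natCast_zmod_val _).symm
  have en' : ((Rat.redMod M (Rat.finUnitHom y) : (ZMod M)ˣ) : ZMod M) = (n' : ZMod M) := (ZMod.natCast_zmod_val _).symm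
  rw [en, en', map_natCast]
  exact_mod_cast hzmod

end Congruence

/-! ### `ẑ ∩ (𝔸_ℚ^∞)ˣ = ℕ_{>0} · ẑˣ` -/

section Decomposition

/-- **An integral finite idele is a positive integer times a unit**: if `y ∈ (𝔸_ℚ^∞)ˣ` has all
components integral, then `y = m · w` with `m ≥ 1` an integer and `w ∈ ẑˣ` (class number one of
`ℤ`: `(𝔸_ℚ^∞)ˣ = ℚ_{>0}ˣ ẑˣ`, `Rat.FiniteAdeleRing.exists_pos_valued_algebraMap_mul_eq_one`, and a
positive rational integral at every prime is a positive integer). [cite: Gelbart1975, (3.3)] -/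
theorem Rat.exists_natCast_mul_of_integral (y : (FiniteAdeleRing (𝓞 ℚ) ℚ)ˣ)
    (hy : ∀ v : HeightOneSpectrum (𝓞 ℚ), Valued.v ((y : FiniteAdeleRing (𝓞 ℚ) ℚ) v) ≤ 1) :
    ∃ (m : ℕ) (w : (FiniteAdeleRing (𝓞 ℚ) ℚ)ˣ), m ≠ 0 ∧ w ∈ Rat.finiteIntegralUnits ∧
      (y : FiniteAdeleRing (𝓞 ℚ) ℚ) = algebraMap ℚ (FiniteAdeleRing (𝓞 ℚ) ℚ) (m : ℚ) * w := by
  obtain ⟨r, hr, hru⟩ := Rat.FiniteAdeleRing.exists_pos_valued_algebraMap_mul_eq_one y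
  have hr0 : r ≠ 0 := hr.ne'
  -- `r⁻¹` is integral at every prime: `|r⁻¹|_v = |y_v|_v ≤ 1`
  have hint : ∀ v : HeightOneSpectrum (𝓞 ℚ), v.valuation ℚ r⁻¹ ≤ 1 := fun v => by
    have h := hru v
    rw [FiniteAdeleRing.mul_apply', Valuation.map_mul, FiniteAdeleRing.algebraMap_apply,
      valuedAdicCompletion_eq_valuation'] at h
    have hrv : v.valuation ℚ r ≠ 0 := (Valuation.ne_zero_iff _).2 hr0
    rw [map_inv₀, inv_le_one₀ (zero_lt_iff.2 hrv)]
    calc (1 : WithZero (Multiplicative ℤ)) = v.valuation ℚ r * Valued.v ((y : FiniteAdeleRing (𝓞 ℚ) ℚ) v) := h.symm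
      _ ≤ v.valuation ℚ r * 1 := mul_le_mul' le_rfl (hy v)
      _ = v.valuation ℚ r := mul_one _
  obtain ⟨z, hz⟩ := Rat.exists_intCast_eq_of_valuation_le_one hint
  have hzpos : 0 < z := by
    have : (0 : ℚ) < z := by rw [hz]; exact inv_pos.2 hr
    exact_mod_cast this
  set rU : ℚˣ := Units.mk0 r hr0 with hrU
  set w : (FiniteAdeleRing (𝓞 ℚ) ℚ)ˣ :=
    Units.map (algebraMap ℚ (FiniteAdeleRing (𝓞 ℚ) ℚ) : ℚ →* FiniteAdeleRing (𝓞 ℚ) ℚ) rU * y with hw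
  refine ⟨z.toNat, w, by omega, fun v => ?_, ?_⟩
  · rw [hw, Units.val_mul, Units.coe_map, MonoidHom.coe_coe, hrU, Units.val_mk0]
    exact hru v
  · rw [hw, Units.val_mul, Units.coe_map, MonoidHom.coe_coe, hrU, Units.val_mk0, ← mul_assoc, ← map_mul]
    have e : ((z.toNat : ℕ) : ℚ) * r = 1 := by
      have : ((z.toNat : ℕ) : ℚ) = (z : ℚ) := by exact_mod_cast Int.toNat_of_nonneg hzpos.le
      rw [this, hz, inv_mul_cancel₀ hr0]
    rw [e, map_one, one_mul]

end Decomposition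

end Literature.NumberTheory.Automorphic

end
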